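import Mathlib
import Summits.Ventures.PercRepro2.HCov
import Summits.Ventures.PercRepro2.BHKAvoid
import Summits.Ventures.PercRepro2.ExploreA3
import Summits.Ventures.PercRepro2.RootLeafUSigns
import Summits.Ventures.PercRepro2.RootLeafUHalf

/-!
# (G4-u): the `o ∈ L` half of the second coefficient at `o = u` — the o-free core `(OU)` is
non-negative (blind cell PercRepro2, p4 g6; proofs/P4-G6-OU.md)

`T2oL p ends o a₂ c b u` (RootLeafUHalf) is the `o ∈ L` half of the second Bernstein coefficient
of the root-leaf cubic; it is linear in the `o ∈ L` row.  Evaluated at `o := u` (every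
configuration of `Q = {u ↮ a₂}` has `o ∈ L`) it becomes the **o-free core**

  `T2oL(o := u) = A·P(PD) + (A + B)·P(T) + 2β·P(T, b ∈ L) − 2β·P(R, b ∈ K)`,

`R = {u ↮ a₂, u ↮ c} = PD ⊔ T`, `A = α + κ`, `B = α − κ`, `β = P(PD) + d0·Z` — the constant
term of the exploration form `T2oL/2 = E[1_{o ∈ L} Φ(L)]` of `T2oL` (every other instance
`o` differs from it by the covariance of `1_{o ∈ L}` with `Φ`).  With the one-root numbers
`hb = P(a₂ ↔ b)`, `d0 = P(a₂ ↮ c)` and the masses `Z = P(Q)`, `W = P(R)`, `D = P(PD)`,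
`t = P(T)`:

* **`T2oL_root_eq`**: the exact four-product form
  `T2oL(o := u) = 2·[(D − d0·W)·(Z·hb − P(Q, bK)) + d0·Z·(W·hb − P(R, bK))
                     + P(Q, bL)·(P(a₂ ↔ c)·W − t) + d0·Z·P(T, bL)]`
  (a linear identity in the pattern masses after the splits `Q = PD ⊔ T ⊔ T′`, `R = PD ⊔ T`);
* **`T2oL_root_nonneg`**: `0 ≤ T2oL(o := u)` — every factor is non-negative:
  `P(Q, bK) ≤ Z·hb` and `P(R, bK) ≤ W·hb` (Harris, a decreasing and an increasing event),
  `d0·W ≤ D` (Harris, two decreasing events: `{a₂ ↮ c}` and `R`), and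
  `t ≤ P(a₂ ↔ c)·W` (`prob_T_le`: explore `C(u)` avoiding `{a₂, c}`; the residual connection
  probability `P_{G∖C(u)}(a₂ ↔ c)` is at most the global one).

So the sign `0 ≤ T2oL` of (G4-u) holds whenever `o` is glued to `u` (in particular for `o`
pendant at `u`); the general instance is `T2oL/2 = P(Q, oL, c∉L)·(OU)/W + W·Cov_W(1_{oL}, Ψ)`.
-/

namespace Summit.Ventures.PercRepro2

open UnionCluster CovForm

namespace RootLeafU

variable {V : Type*} {E : Type*} [Fintype E] [DecidableEq E] [Fintype V] [DecidableEq V]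
  {R : Type*} [Field R] [LinearOrder R] [IsStrictOrderedRing R]

section Helpers

variable (ends : E → Sym2 V)

omit [Fintype E] [DecidableEq E] [Fintype V] [DecidableEq V] in
/-- `{u ↔ u}` is everything. -/
lemma connEvent_self (u : V) : connEvent ends u u = Set.univ :=
  Set.eq_univ_of_forall fun ω => conn_refl ends ω u

omit [Fintype E] [DecidableEq E] [Fintype V] [DecidableEq V] in
/-- `{s ↮ X}` is a decreasing event. -/
lemma isLowerSet_avoidAll_finset (s : V) (X : Finset V) : IsLowerSet (avoidAll ends s X) := by
  intro ω ω' hle hω x hx hc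
  exact hω x hx (conn_mono hle hc)

end Helpers

section Ou

variable (p : E → R) (ends : E → Sym2 V) (a₂ c b u : V)

/-- **The tower bound for `T`**: `P(T) ≤ P(a₂ ↔ c) · P(R)`, `R = {u ↮ a₂, u ↮ c}`: explore
`C(u)` avoiding `{a₂, c}`; given `C(u)` the cluster of `a₂` lives in `G ∖ C(u)`, whose
connection probability `P_{G∖C(u)}(a₂ ↔ c)` is at most `P(a₂ ↔ c)` (`delClusterProb_mem_le`). -/
lemma prob_T_le (hp : IsProbVec p) :
    prob p (TEvent ends u a₂ c) ≤
      prob p (connEvent ends a₂ c) * prob p (avoidAll ends u {a₂, c}) := by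
  classical
  have ha2 : a₂ ∈ ({a₂, c} : Finset V) := by simp
  have tB := prob_clusterIn_inter_avoid_eq_expect p ends u a₂ ha2 Set.univ {W | c ∈ W}
  have t1 := prob_clusterIn_inter_avoid_eq_expect p ends u a₂ ha2 Set.univ Set.univ
  have hg1 : ∀ K, delClusterProb p ends a₂ Set.univ K = 1 := delClusterProb_univ p ends a₂
  simp only [clusterInEvent_univ, Set.univ_inter, hg1, mul_one, Set.indicator_univ, Pi.one_apply,
    one_mul] at tB t1
  rw [ExploreA3.clusterInEvent_mem_eq, conn_inter_R] at tB
  rw [tB, t1, ← expect_const_mul]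
  refine expect_mono hp fun ω => ?_
  have h1 : delClusterProb p ends a₂ {W | c ∈ W} (cluster ends ω u) ≤
      prob p (connEvent ends a₂ c) := delClusterProb_mem_le p ends hp a₂ c _
  have h3 : (0 : R) ≤ (avoidAll ends u {a₂, c}).indicator 1 ω :=
    Set.indicator_apply_nonneg fun _ => zero_le_one
  exact mul_le_mul_of_nonneg_right h1 h3

omit [Fintype V] in
/-- **The four-product form of the o-free core**: with `Z = P(Q)`, `W = P(R)`, `D = P(PD)`,
`t = P(T)`, `hb = P(a₂ ↔ b)`, `d0 = P(a₂ ↮ c)`,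
`T2oL(o := u) = 2·[(D − d0·W)·(Z·hb − P(Q,bK)) + d0·Z·(W·hb − P(R,bK)) + P(Q,bL)·(P(a₂↔c)·W − t)
+ d0·Z·P(T,bL)]`. -/
theorem T2oL_root_eq :
    T2oL p ends u a₂ c b u =
      2 * ((prob p (PDEvent ends u a₂ c) -
              prob p (avoidAll ends a₂ {c}) * prob p (avoidAll ends u {a₂, c})) *
            (prob p (avoidAll ends a₂ {u}) * prob p (connEvent ends a₂ b) -
              prob p (avoidAll ends a₂ {u} ∩ connEvent ends a₂ b)) +
          prob p (avoidAll ends a₂ {c}) * prob p (avoidAll ends a₂ {u}) *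
            (prob p (avoidAll ends u {a₂, c}) * prob p (connEvent ends a₂ b) -
              prob p (avoidAll ends u {a₂, c} ∩ connEvent ends a₂ b)) +
          prob p (avoidAll ends a₂ {u} ∩ connEvent ends u b) *
            (prob p (connEvent ends a₂ c) * prob p (avoidAll ends u {a₂, c}) -
              prob p (TEvent ends u a₂ c)) +
          prob p (avoidAll ends a₂ {c}) * prob p (avoidAll ends a₂ {u}) *
            prob p (TEvent ends u a₂ c ∩ connEvent ends u b)) := by
  have hZ := Qsplit_univ p ends u a₂ c
  have hbK := Qsplit p ends u a₂ c (connEvent ends a₂ b)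
  have hbL := Qsplit p ends u a₂ c (connEvent ends u b)
  have hgap := gap_eq_Q p ends u a₂ b
  have hR : prob p (PDEvent ends u a₂ c) + prob p (TEvent ends u a₂ c) =
      prob p (avoidAll ends u {a₂, c}) := by
    have h := ISplit.prob_PD_add_T p ends u a₂ c Set.univ
    simpa only [Set.inter_univ] using h
  have hRbK := ISplit.prob_PD_add_T p ends u a₂ c (connEvent ends a₂ b)
  have hd0 : prob p (avoidAll ends a₂ {c}) = 1 - prob p (connEvent ends a₂ c) := by
    rw [avoidAll_singleton_eq, prob_compl]
  unfold T2oL EQb3 PDb EQ3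
  rw [connEvent_self]
  simp only [Set.inter_univ, Set.univ_inter, prob_univ]
  rw [hgap, hZ, hbK, hbL, ← hR, ← hRbK, hd0]
  ring

/-- **`0 ≤ T2oL` at `o = u`** — the o-free core of the `o ∈ L` half of the second coefficient is
non-negative: each of the four products of `T2oL_root_eq` has non-negative factors (Harris
three times, the tower bound `prob_T_le` once). -/
theorem T2oL_root_nonneg (hp : IsProbVec p) : 0 ≤ T2oL p ends u a₂ c b u := by
  classical
  rw [T2oL_root_eq]
  have hQ : IsLowerSet (avoidAll ends a₂ {u}) := isLowerSet_avoidAll_finset ends a₂ {u}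
  have hRl : IsLowerSet (avoidAll ends u {a₂, c}) := isLowerSet_avoidAll_finset ends u {a₂, c}
  have hcl : IsLowerSet (avoidAll ends a₂ {c}) := isLowerSet_avoidAll_finset ends a₂ {c}
  -- (H1) `P(Q, bK) ≤ Z·hb`
  have H1 := prob_inter_le_prob_mul_prob_of_isLowerSet hp hQ (isUpperSet_connEvent ends a₂ b)
  -- (H3) `P(R, bK) ≤ W·hb`
  have H3 := prob_inter_le_prob_mul_prob_of_isLowerSet hp hRl (isUpperSet_connEvent ends a₂ b)
  -- (H2) `d0·W ≤ P(a₂ ↮ c, R) = D`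
  have H2 := prob_mul_prob_le_prob_inter_of_isLowerSet hp hcl hRl
  have hPD : prob p (avoidAll ends a₂ {c} ∩ avoidAll ends u {a₂, c}) =
      prob p (PDEvent ends u a₂ c) := by
    have h := prob_inter_add_prob_inter_compl p (avoidAll ends u {a₂, c}) (connEvent ends a₂ c)
    have hR : prob p (PDEvent ends u a₂ c) + prob p (TEvent ends u a₂ c) =
        prob p (avoidAll ends u {a₂, c}) := by
      have h' := ISplit.prob_PD_add_T p ends u a₂ c Set.univ
      simpa only [Set.inter_univ] using h'
    have e1 : avoidAll ends u {a₂, c} ∩ connEvent ends a₂ c = TEvent ends u a₂ c := by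
      rw [Set.inter_comm, conn_inter_R]
    have e2 : avoidAll ends a₂ {c} ∩ avoidAll ends u {a₂, c} =
        avoidAll ends u {a₂, c} ∩ (connEvent ends a₂ c)ᶜ := by
      rw [avoidAll_singleton_eq, Set.inter_comm]
    rw [e1] at h
    rw [e2]
    linarith
  -- (H5) `t ≤ P(a₂ ↔ c)·W`
  have H5 := prob_T_le p ends a₂ c u hp
  have n1 := prob_nonneg hp (avoidAll ends a₂ {c})
  have n2 := prob_nonneg hp (avoidAll ends a₂ {u})
  have n3 := prob_nonneg hp (avoidAll ends a₂ {u} ∩ connEvent ends u b)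
  have n4 := prob_nonneg hp (TEvent ends u a₂ c ∩ connEvent ends u b)
  have f1 : 0 ≤ prob p (PDEvent ends u a₂ c) -
      prob p (avoidAll ends a₂ {c}) * prob p (avoidAll ends u {a₂, c}) := by linarith
  have f2 : 0 ≤ prob p (avoidAll ends a₂ {u}) * prob p (connEvent ends a₂ b) -
      prob p (avoidAll ends a₂ {u} ∩ connEvent ends a₂ b) := by linarith
  have f3 : 0 ≤ prob p (avoidAll ends u {a₂, c}) * prob p (connEvent ends a₂ b) -
      prob p (avoidAll ends u {a₂, c} ∩ connEvent ends a₂ b) := by linarith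
  have f4 : 0 ≤ prob p (connEvent ends a₂ c) * prob p (avoidAll ends u {a₂, c}) -
      prob p (TEvent ends u a₂ c) := by linarith
  have g1 := mul_nonneg f1 f2
  have g2 := mul_nonneg (mul_nonneg n1 n2) f3
  have g3 := mul_nonneg n3 f4
  have g4 := mul_nonneg (mul_nonneg n1 n2) n4
  linarith

end Ou

end RootLeafU

end Summit.Ventures.PercRepro2
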